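import Mathlib
import Summits.Ventures.DiscreteObjects.Mahler.SmallMeasureCensus
import Summits.Ventures.DiscreteObjects.Mahler.LehmerLowerBound

/-!
# Lehmer's constant in the kernel: `M(L)` is the largest root and `1.176280818259 < M(L) < 1.176280818260`

Cell `pub-namedobj`, seat `pub-namedobj-mahler-g2`, target (L). Framing: lottery ticket; floor = certified
bounds/negative ranges.

`LehmerLowerBound.lean` proved `1.17628 < M(L)` for Lehmer's polynomial
`L = x¹⁰+x⁹-x⁷-x⁶-x⁵-x⁴-x³+x+1` and left the upper bound open ("needs the location of the other nine
roots"). Here we locate all ten roots and COMPUTE `M(L)` exactly, kernel-checked: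

* `L(x) = x⁵·Q(x + 1/x)` with the trace polynomial `Q(y) = y⁵+y⁴-5y³-5y²+4y+3`;
* `Q` has five real roots `y₁ < y₂ < y₃ < y₄ < 2 < y₅` (intermediate value theorem on rational brackets),
  hence `Q = ∏ (y - yᵢ)` and `L = ∏ᵢ (x² - yᵢx + 1)` over `ℂ`;
* `M(x² - yx + 1) = 1` for `|y| < 2` (both roots on the unit circle) and `= (y + √(y²-4))/2` for `y > 2`;
* so `M(L) = (y₅ + √(y₅²-4))/2`, the root `α > 1` of `L` (`lehmer_measure_eq_largest_root`), and from
  `Q(c + 1/c) < 0 < Q(c' + 1/c')` with `c = 1.176280818259`, `c' = 1.176280818260`: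
  `c < M(L) < c'` (`lehmer_measure_enclosure`), in particular `M(L) < 1.17629`
  (`lehmer_measure_upper_bound`).

This is the cell's control C+L1 (Lehmer's measure `1.1762808182599175…`, three numerical engines) reproduced
inside the Lean kernel to 12 digits.
-/

namespace Summit.Ventures.DiscreteObjects.Mahler

open Polynomial

/-! ## Quadratic reciprocal factors -/

/-- For `-2 < y < 2` the polynomial `x² - yx + 1` has both roots on the unit circle: `M = 1`. -/
theorem mahlerMeasure_quad_of_abs_lt_two {y : ℝ} (h1 : -2 < y) (h2 : y < 2) :
    (X ^ 2 - C (y : ℂ) * X + 1 : ℂ[X]).mahlerMeasure = 1 := by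
  have hpos : 0 ≤ 4 - y ^ 2 := by nlinarith
  set s : ℝ := Real.sqrt (4 - y ^ 2) with hs
  have hs2 : s ^ 2 = 4 - y ^ 2 := by rw [hs]; exact Real.sq_sqrt hpos
  set z₁ : ℂ := ((y : ℂ) + (s : ℂ) * Complex.I) / 2 with hz₁
  set z₂ : ℂ := ((y : ℂ) - (s : ℂ) * Complex.I) / 2 with hz₂
  have hs2c : (s : ℂ) ^ 2 = 4 - (y : ℂ) ^ 2 := by exact_mod_cast hs2
  have hsum : z₁ + z₂ = (y : ℂ) := by rw [hz₁, hz₂]; ring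
  have hprod : z₁ * z₂ = 1 := by
    rw [hz₁, hz₂]
    have hI : Complex.I ^ 2 = -1 := Complex.I_sq
    linear_combination (1 / 4 : ℂ) * hs2c - ((s : ℂ) ^ 2 / 4) * hI
  have hfac : (X ^ 2 - C (y : ℂ) * X + 1 : ℂ[X]) = (X - C z₁) * (X - C z₂) := by
    have : (X - C z₁) * (X - C z₂) = X ^ 2 - C (z₁ + z₂) * X + C (z₁ * z₂) := by
      rw [map_add, map_mul]; ring
    rw [this, hsum, hprod, map_one]
  have hconj : (starRingEnd ℂ) z₁ = z₂ := by
    rw [hz₁, hz₂]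
    simp [map_div₀, Complex.conj_ofReal, map_ofNat, sub_eq_add_neg]
  have hn1 : ‖z₁‖ = 1 := by
    have h := Complex.mul_conj z₁
    rw [hconj, hprod] at h
    -- h : 1 = ↑(Complex.normSq z₁)
    have hsq : Complex.normSq z₁ = 1 := by exact_mod_cast h.symm
    have : ‖z₁‖ ^ 2 = 1 := by rw [← Complex.normSq_eq_norm_sq]; exact hsq
    nlinarith [norm_nonneg z₁]
  have hn2 : ‖z₂‖ = 1 := by rw [← hconj, Complex.norm_conj]; exact hn1
  rw [hfac, mahlerMeasure_mul, mahlerMeasure_X_sub_C, mahlerMeasure_X_sub_C, hn1, hn2]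
  simp

/-- For `y > 2` the polynomial `x² - yx + 1` has the real roots `(y ± √(y²-4))/2`, product `1`:
`M = (y + √(y²-4))/2`. -/
theorem mahlerMeasure_quad_of_two_lt {y : ℝ} (h : 2 < y) :
    (X ^ 2 - C (y : ℂ) * X + 1 : ℂ[X]).mahlerMeasure = (y + Real.sqrt (y ^ 2 - 4)) / 2 := by
  have hpos : 0 ≤ y ^ 2 - 4 := by nlinarith
  set t : ℝ := Real.sqrt (y ^ 2 - 4) with ht
  have ht2 : t ^ 2 = y ^ 2 - 4 := by rw [ht]; exact Real.sq_sqrt hpos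
  have ht0 : 0 ≤ t := Real.sqrt_nonneg _
  have hty : t < y := by nlinarith
  set r₁ : ℝ := (y + t) / 2 with hr₁
  set r₂ : ℝ := (y - t) / 2 with hr₂
  have hsum : r₁ + r₂ = y := by rw [hr₁, hr₂]; ring
  have hprod : r₁ * r₂ = 1 := by rw [hr₁, hr₂]; nlinarith
  have hr1 : 1 ≤ r₁ := by rw [hr₁]; linarith
  have hr2pos : 0 < r₂ := by rw [hr₂]; linarith
  have hr2le : r₂ ≤ 1 := by nlinarith
  have hfac : (X ^ 2 - C (y : ℂ) * X + 1 : ℂ[X]) = (X - C (r₁ : ℂ)) * (X - C (r₂ : ℂ)) := by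
    have : (X - C (r₁ : ℂ)) * (X - C (r₂ : ℂ)) = X ^ 2 - C ((r₁ : ℂ) + r₂) * X + C ((r₁ : ℂ) * r₂) := by
      rw [map_add, map_mul]; ring
    rw [this]
    have h1 : (r₁ : ℂ) + r₂ = (y : ℂ) := by exact_mod_cast hsum
    have h2 : (r₁ : ℂ) * r₂ = 1 := by exact_mod_cast hprod
    rw [h1, h2, map_one]
  rw [hfac, mahlerMeasure_mul, mahlerMeasure_X_sub_C, mahlerMeasure_X_sub_C, Complex.norm_real,
    Complex.norm_real, Real.norm_of_nonneg (by linarith), Real.norm_of_nonneg hr2pos.le,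
    max_eq_right hr1, max_eq_left hr2le, mul_one]

/-- Monotonicity of `r ↦ r + 1/r` on `[1, ∞)`, in the form used for the enclosures. -/
theorem lt_of_add_inv_lt_add_inv {r c : ℝ} (hc : 1 ≤ c) (hr : 0 < r) (h : r + r⁻¹ < c + c⁻¹) : r < c := by
  by_contra hle
  rw [not_lt] at hle
  have hc0 : 0 < c := by linarith
  have key : (r + r⁻¹) - (c + c⁻¹) = (r - c) * (r * c - 1) / (r * c) := by
    field_simp
    ring
  have hnum : 0 ≤ (r - c) * (r * c - 1) := by
    apply mul_nonneg
    · linarith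
    · nlinarith
  have : 0 ≤ (r + r⁻¹) - (c + c⁻¹) := by rw [key]; positivity
  linarith

/-! ## The trace polynomial `Q(y) = y⁵+y⁴-5y³-5y²+4y+3` -/

/-- `L(x) = x⁵·Q(x + 1/x)` for `x ≠ 0`. -/
theorem lehmer_eval_eq_trace {K : Type*} [Field K] (x : K) (hx : x ≠ 0) :
    x ^ 10 + x ^ 9 - x ^ 7 - x ^ 6 - x ^ 5 - x ^ 4 - x ^ 3 + x + 1 =
      x ^ 5 * ((x + x⁻¹) ^ 5 + (x + x⁻¹) ^ 4 - 5 * (x + x⁻¹) ^ 3 - 5 * (x + x⁻¹) ^ 2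
        + 4 * (x + x⁻¹) + 3) := by
  field_simp
  ring

/-- The five real roots of the trace polynomial, with rational brackets (intermediate value theorem);
the bracket of the largest root is `(c + 1/c, c' + 1/c')` with `c = 1.176280818259`, `c' = 1.176280818260`. -/
theorem lehmer_trace_roots :
    ∃ y₁ y₂ y₃ y₄ y₅ : ℝ,
      (-2 < y₁ ∧ y₁ < -17 / 10) ∧ (-17 / 10 < y₂ ∧ y₂ < -1) ∧ (-1 < y₃ ∧ y₃ < 0) ∧ (0 < y₄ ∧ y₄ < 1) ∧
      ((1176280818259 / 10 ^ 12 : ℝ) + (1176280818259 / 10 ^ 12)⁻¹ < y₅ ∧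
        y₅ < (1176280818260 / 10 ^ 12 : ℝ) + (1176280818260 / 10 ^ 12)⁻¹) ∧
      ∀ y ∈ [y₁, y₂, y₃, y₄, y₅], y ^ 5 + y ^ 4 - 5 * y ^ 3 - 5 * y ^ 2 + 4 * y + 3 = 0 := by
  set f : ℝ → ℝ := fun y => y ^ 5 + y ^ 4 - 5 * y ^ 3 - 5 * y ^ 2 + 4 * y + 3 with hf
  have hcont : Continuous f := by
    rw [hf]; fun_prop
  have root : ∀ a b : ℝ, a ≤ b → (f a < 0 ∧ 0 < f b) ∨ (f b < 0 ∧ 0 < f a) →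
      ∃ y, a < y ∧ y < b ∧ f y = 0 := by
    intro a b hab h
    rcases h with ⟨ha, hb⟩ | ⟨hb, ha⟩
    · obtain ⟨y, hy, hfy⟩ := intermediate_value_Ioo hab hcont.continuousOn ⟨ha, hb⟩
      exact ⟨y, hy.1, hy.2, hfy⟩
    · obtain ⟨y, hy, hfy⟩ := intermediate_value_Ioo' hab hcont.continuousOn ⟨hb, ha⟩
      exact ⟨y, hy.1, hy.2, hfy⟩
  obtain ⟨y₁, h1a, h1b, h1f⟩ := root (-2) (-17 / 10) (by norm_num)
    (Or.inl ⟨by rw [hf]; norm_num, by rw [hf]; norm_num⟩)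
  obtain ⟨y₂, h2a, h2b, h2f⟩ := root (-17 / 10) (-1) (by norm_num)
    (Or.inr ⟨by rw [hf]; norm_num, by rw [hf]; norm_num⟩)
  obtain ⟨y₃, h3a, h3b, h3f⟩ := root (-1) 0 (by norm_num)
    (Or.inl ⟨by rw [hf]; norm_num, by rw [hf]; norm_num⟩)
  obtain ⟨y₄, h4a, h4b, h4f⟩ := root 0 1 (by norm_num)
    (Or.inr ⟨by rw [hf]; norm_num, by rw [hf]; norm_num⟩)
  obtain ⟨y₅, h5a, h5b, h5f⟩ := root ((1176280818259 / 10 ^ 12 : ℝ) + (1176280818259 / 10 ^ 12)⁻¹)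
    ((1176280818260 / 10 ^ 12 : ℝ) + (1176280818260 / 10 ^ 12)⁻¹) (by norm_num)
    (Or.inl ⟨by rw [hf]; norm_num, by rw [hf]; norm_num⟩)
  refine ⟨y₁, y₂, y₃, y₄, y₅, ⟨h1a, h1b⟩, ⟨h2a, h2b⟩, ⟨h3a, h3b⟩, ⟨h4a, h4b⟩, ⟨h5a, h5b⟩, ?_⟩
  intro y hy
  simp only [List.mem_cons, List.not_mem_nil, or_false] at hy
  rcases hy with rfl | rfl | rfl | rfl | rfl
  · exact h1f
  · exact h2f
  · exact h3f
  · exact h4f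
  · exact h5f

/-! ## `M(L)` exactly -/

/-- **Lehmer's constant is the largest root.** `M(L) = (y₅ + √(y₅² - 4))/2` where `y₅` is the root of the
trace polynomial in `(2.0264179491867, 2.0264179491870)`; equivalently `M(L)` is the unique root `α > 1`
of `L` (`α + 1/α = y₅`), the other nine roots being `1/α` and eight numbers of modulus `1`. -/
theorem lehmer_measure_eq_largest_root : ∃ y : ℝ,
    (1176280818259 / 10 ^ 12 : ℝ) + (1176280818259 / 10 ^ 12)⁻¹ < y ∧
    y < (1176280818260 / 10 ^ 12 : ℝ) + (1176280818260 / 10 ^ 12)⁻¹ ∧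
    y ^ 5 + y ^ 4 - 5 * y ^ 3 - 5 * y ^ 2 + 4 * y + 3 = 0 ∧
    intMahlerMeasure lehmerPoly = (y + Real.sqrt (y ^ 2 - 4)) / 2 := by
  obtain ⟨y₁, y₂, y₃, y₄, y₅, h1, h2, h3, h4, h5, hroots⟩ := lehmer_trace_roots
  have hc_lo : (2 : ℝ) < (1176280818259 / 10 ^ 12 : ℝ) + (1176280818259 / 10 ^ 12)⁻¹ := by norm_num
  have hy5 : 2 < y₅ := lt_trans hc_lo h5.1
  refine ⟨y₅, h5.1, h5.2, hroots y₅ (by simp), ?_⟩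
  -- the roots as complex numbers, and the root equations over ℂ
  have hrootsC : ∀ y ∈ [y₁, y₂, y₃, y₄, y₅],
      (y : ℂ) ^ 5 + (y : ℂ) ^ 4 - 5 * (y : ℂ) ^ 3 - 5 * (y : ℂ) ^ 2 + 4 * (y : ℂ) + 3 = 0 := by
    intro y hy
    exact_mod_cast hroots y hy
  obtain ⟨s, hs⟩ : ∃ s : Multiset ℂ, s = {(y₁ : ℂ), (y₂ : ℂ), (y₃ : ℂ), (y₄ : ℂ), (y₅ : ℂ)} := ⟨_, rfl⟩
  -- pairwise distinct
  have h12 : (y₁ : ℂ) ≠ y₂ := by exact_mod_cast ne_of_lt (by linarith [h1.2, h2.1] : y₁ < y₂)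
  have h13 : (y₁ : ℂ) ≠ y₃ := by exact_mod_cast ne_of_lt (by linarith [h1.2, h3.1] : y₁ < y₃)
  have h14 : (y₁ : ℂ) ≠ y₄ := by exact_mod_cast ne_of_lt (by linarith [h1.2, h4.1] : y₁ < y₄)
  have h15 : (y₁ : ℂ) ≠ y₅ := by exact_mod_cast ne_of_lt (by linarith [h1.2, hy5] : y₁ < y₅)
  have h23 : (y₂ : ℂ) ≠ y₃ := by exact_mod_cast ne_of_lt (by linarith [h2.2, h3.1] : y₂ < y₃)
  have h24 : (y₂ : ℂ) ≠ y₄ := by exact_mod_cast ne_of_lt (by linarith [h2.2, h4.1] : y₂ < y₄)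
  have h25 : (y₂ : ℂ) ≠ y₅ := by exact_mod_cast ne_of_lt (by linarith [h2.2, hy5] : y₂ < y₅)
  have h34 : (y₃ : ℂ) ≠ y₄ := by exact_mod_cast ne_of_lt (by linarith [h3.2, h4.1] : y₃ < y₄)
  have h35 : (y₃ : ℂ) ≠ y₅ := by exact_mod_cast ne_of_lt (by linarith [h3.2, hy5] : y₃ < y₅)
  have h45 : (y₄ : ℂ) ≠ y₅ := by exact_mod_cast ne_of_lt (by linarith [h4.2, hy5] : y₄ < y₅)
  have hs_card : Multiset.card s = 5 := by rw [hs]; simp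
  have hs_nodup : s.Nodup := by
    rw [hs]
    simp [Multiset.insert_eq_cons, h12, h13, h14, h15, h23, h24, h25, h34, h35, h45]
  -- the trace polynomial over ℂ
  have hQeval : ∀ t : ℂ, (X ^ 5 + X ^ 4 - 5 * X ^ 3 - 5 * X ^ 2 + 4 * X + 3 : ℂ[X]).eval t =
      t ^ 5 + t ^ 4 - 5 * t ^ 3 - 5 * t ^ 2 + 4 * t + 3 := by
    intro t; simp
  have hQmonic : (X ^ 5 + X ^ 4 - 5 * X ^ 3 - 5 * X ^ 2 + 4 * X + 3 : ℂ[X]).Monic := by monicity!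
  have hQdeg : (X ^ 5 + X ^ 4 - 5 * X ^ 3 - 5 * X ^ 2 + 4 * X + 3 : ℂ[X]).natDegree = 5 := by
    compute_degree!
  have hQne : (X ^ 5 + X ^ 4 - 5 * X ^ 3 - 5 * X ^ 2 + 4 * X + 3 : ℂ[X]) ≠ 0 := hQmonic.ne_zero
  have hs_sub : s ⊆ (X ^ 5 + X ^ 4 - 5 * X ^ 3 - 5 * X ^ 2 + 4 * X + 3 : ℂ[X]).roots := by
    intro w hw
    rw [mem_roots hQne, IsRoot.def, hQeval]
    rw [hs] at hw
    simp only [Multiset.insert_eq_cons, Multiset.mem_cons, Multiset.mem_singleton] at hw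
    rcases hw with rfl | rfl | rfl | rfl | rfl
    · exact hrootsC y₁ (by simp)
    · exact hrootsC y₂ (by simp)
    · exact hrootsC y₃ (by simp)
    · exact hrootsC y₄ (by simp)
    · exact hrootsC y₅ (by simp)
  have hs_le : s ≤ (X ^ 5 + X ^ 4 - 5 * X ^ 3 - 5 * X ^ 2 + 4 * X + 3 : ℂ[X]).roots :=
    (Multiset.le_iff_subset hs_nodup).mpr hs_sub
  have hroots_eq : (X ^ 5 + X ^ 4 - 5 * X ^ 3 - 5 * X ^ 2 + 4 * X + 3 : ℂ[X]).roots = s := by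
    symm
    apply Multiset.eq_of_le_of_card_le hs_le
    rw [hs_card]
    exact (card_roots' _).trans_eq hQdeg
  have hQsplit : (X ^ 5 + X ^ 4 - 5 * X ^ 3 - 5 * X ^ 2 + 4 * X + 3 : ℂ[X]) =
      (s.map fun w => X - C w).prod := by
    rw [← hroots_eq]
    exact (IsAlgClosed.splits _).eq_prod_roots_of_monic hQmonic
  have hQprod : ∀ t : ℂ, t ^ 5 + t ^ 4 - 5 * t ^ 3 - 5 * t ^ 2 + 4 * t + 3 =
      (t - y₁) * (t - y₂) * (t - y₃) * (t - y₄) * (t - y₅) := by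
    intro t
    have h' := congrArg (Polynomial.eval t) hQsplit
    rw [hQeval, eval_multiset_prod, hs] at h'
    simp only [Multiset.insert_eq_cons, Multiset.map_cons, Multiset.map_singleton, Multiset.prod_cons,
      Multiset.prod_singleton, eval_sub, eval_X, eval_C] at h'
    linear_combination h'
  -- the factorisation of `L` over `ℂ`
  have hLeval : ∀ x : ℂ, (lehmerPoly.map (Int.castRingHom ℂ)).eval x =
      x ^ 10 + x ^ 9 - x ^ 7 - x ^ 6 - x ^ 5 - x ^ 4 - x ^ 3 + x + 1 := by
    intro x
    rw [eval_map, ← algebraMap_int_eq, ← aeval_def, aeval_lehmerPoly]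
  have hLP : lehmerPoly.map (Int.castRingHom ℂ) = (s.map fun w => X ^ 2 - C w * X + 1).prod := by
    apply Polynomial.funext
    intro x
    rw [hLeval, eval_multiset_prod, hs]
    simp only [Multiset.insert_eq_cons, Multiset.map_cons, Multiset.map_singleton, Multiset.prod_cons,
      Multiset.prod_singleton, eval_add, eval_sub, eval_mul, eval_pow, eval_X, eval_C, eval_one]
    rcases eq_or_ne x 0 with rfl | hx
    · norm_num
    · rw [lehmer_eval_eq_trace x hx, hQprod (x + x⁻¹)]
      field_simp
      ring
  -- the Mahler measure
  unfold intMahlerMeasure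
  rw [hLP, prod_mahlerMeasure_eq_mahlerMeasure_prod, Multiset.map_map, hs]
  simp only [Multiset.insert_eq_cons, Multiset.map_cons, Multiset.map_singleton, Multiset.prod_cons,
    Multiset.prod_singleton, Function.comp_apply]
  rw [mahlerMeasure_quad_of_abs_lt_two h1.1 (by linarith [h1.2]),
    mahlerMeasure_quad_of_abs_lt_two (by linarith [h2.1]) (by linarith [h2.2]),
    mahlerMeasure_quad_of_abs_lt_two (by linarith [h3.1]) (by linarith [h3.2]),
    mahlerMeasure_quad_of_abs_lt_two (by linarith [h4.1]) (by linarith [h4.2]),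
    mahlerMeasure_quad_of_two_lt hy5]
  ring

/-- **Kernel enclosure of Lehmer's constant to 12 digits:** `1.176280818259 < M(L) < 1.176280818260`. -/
theorem lehmer_measure_enclosure :
    (1176280818259 / 10 ^ 12 : ℝ) < intMahlerMeasure lehmerPoly ∧
      intMahlerMeasure lehmerPoly < 1176280818260 / 10 ^ 12 := by
  obtain ⟨y, hlo, hhi, _, hM⟩ := lehmer_measure_eq_largest_root
  have hy : 2 < y := lt_trans (by norm_num) hlo
  have hpos : 0 ≤ y ^ 2 - 4 := by nlinarith
  have ht2 : Real.sqrt (y ^ 2 - 4) ^ 2 = y ^ 2 - 4 := Real.sq_sqrt hpos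
  have ht0 : 0 ≤ Real.sqrt (y ^ 2 - 4) := Real.sqrt_nonneg _
  have hty : Real.sqrt (y ^ 2 - 4) < y := by nlinarith
  have hr1 : 1 ≤ (y + Real.sqrt (y ^ 2 - 4)) / 2 := by linarith
  have hr0 : 0 < (y + Real.sqrt (y ^ 2 - 4)) / 2 := by linarith
  have hprod : (y + Real.sqrt (y ^ 2 - 4)) / 2 * ((y - Real.sqrt (y ^ 2 - 4)) / 2) = 1 := by nlinarith
  have hrinv : ((y + Real.sqrt (y ^ 2 - 4)) / 2)⁻¹ = (y - Real.sqrt (y ^ 2 - 4)) / 2 :=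
    inv_eq_of_mul_eq_one_right hprod
  have hsum : (y + Real.sqrt (y ^ 2 - 4)) / 2 + ((y + Real.sqrt (y ^ 2 - 4)) / 2)⁻¹ = y := by
    rw [hrinv]; ring
  rw [hM]
  constructor
  · exact lt_of_add_inv_lt_add_inv hr1 (by norm_num) (by rw [hsum]; exact hlo)
  · exact lt_of_add_inv_lt_add_inv (by norm_num) hr0 (by rw [hsum]; exact hhi)

/-- **Upper bound** complementing `lehmer_measure_lower_bound`: `M(L) < 1.17629`. -/
theorem lehmer_measure_upper_bound : intMahlerMeasure lehmerPoly < 117629 / 100000 :=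
  lt_trans lehmer_measure_enclosure.2 (by norm_num)

/-- The two-sided five-digit statement `1.17628 < M(L) < 1.17629`. -/
theorem lehmer_measure_five_digits :
    (117628 : ℝ) / 100000 < intMahlerMeasure lehmerPoly ∧ intMahlerMeasure lehmerPoly < 117629 / 100000 :=
  ⟨lehmer_measure_lower_bound, lehmer_measure_upper_bound⟩

end Summit.Ventures.DiscreteObjects.Mahler
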